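import Summits.MatrixMultiplication.OmegaCensus.STPP222PowRoutes

/-!
# ω-census: cyclic tricolored-sum-free supply in the `∃`-form used by the product route (sizes 5, 6, 7)

Cell `pub-omega`, ω construction census, seat pub-omega ENG2 (gen 36). HONEST FRAMING (verbatim): lottery ticket; floor =
certified bounds/negative ranges.  Plumbing only: stpp's kernel tables `hasTSF_zmod_tsfCyc` (`ℤ/e` carries a tricolored sum-free set of size `5`
for `e ≥ 13`), `hasTSF_zmod_tsfCyc6` (`6` for `e ≥ 18`) and `hasTSF_zmod_tsfCycG` (`7` for `e ≥ 21`) restated with a numeral size, so that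
`exists_isSTPP_cards_prod_of_tsf_le` can consume them in the product-route seed files of the `(2,1,1)^k` order laws (`…T1K13ProdSeeds*`).
References: J. Blasiak, T. Church, H. Cohn, J. Grochow, E. Naslund, W. Sawin, C. Umans, Discrete Analysis 2017:3, Def. 3.1.
-/

open Literature.Computability.AlgebraicComplexity Literature.Combinatorics.Additive Finset

namespace Summit.MatrixMultiplication.OmegaCensus

/-- `ℤ/q` carries a tricolored sum-free set of size `5` for every `q ≥ 13` (`hasTSF_zmod_tsfCyc`). [cite: BlasiakChurchCohnGrochowNaslundSawinUmans2017, Def. 3.1] -/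
theorem exists_isTSF_five_zmod_of_le13 (q : ℕ) (hq : 13 ≤ q) : ∃ s t u : Fin 5 → ZMod q, IsTricoloredSumFree s t u := by
  have h := N5Kit.hasTSF_zmod_tsfCyc q
  unfold N5Kit.tsfCyc at h
  rw [if_pos hq] at h
  exact h

/-- `ℤ/q` carries a tricolored sum-free set of size `6` for every `q ≥ 18` (`hasTSF_zmod_tsfCyc6`). [cite: BlasiakChurchCohnGrochowNaslundSawinUmans2017, Def. 3.1] -/
theorem exists_isTSF_six_zmod_of_le18 (q : ℕ) (hq : 18 ≤ q) : ∃ s t u : Fin 6 → ZMod q, IsTricoloredSumFree s t u := by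
  have h := N6From290.hasTSF_zmod_tsfCyc6 q
  unfold N6From290.tsfCyc6 at h
  rw [if_pos hq] at h
  exact h

/-- `ℤ/q` carries a tricolored sum-free set of size `7` for every `q ≥ 21` (`hasTSF_zmod_tsfCycG`). [cite: BlasiakChurchCohnGrochowNaslundSawinUmans2017, Def. 3.1] -/
theorem exists_isTSF_seven_zmod_of_le21 (q : ℕ) (hq : 21 ≤ q) : ∃ s t u : Fin 7 → ZMod q, IsTricoloredSumFree s t u := by
  have h := NkRoutes.hasTSF_zmod_tsfCycG q
  unfold NkRoutes.tsfCycG at h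
  rw [if_pos hq] at h
  exact h

end Summit.MatrixMultiplication.OmegaCensus
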